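import Mathlib
import Literature.Computability.AlgebraicComplexity.LMR13PermanentNotTangentThree
import Literature.Computability.AlgebraicComplexity.AlperBogartVelascoProofs
import Summits.ValiantsHypothesis.ValiantsHypothesis.Theorems.GrenetZeonTwoDimCoefficientsDefs
import Summits.ValiantsHypothesis.ValiantsHypothesis.Theorems.GrenetZeonTwoDimCoefficientsStubClassify
import Summits.ValiantsHypothesis.ValiantsHypothesis.Theorems.GrenetZeonTwoDimCoefficientsDualUnipotentTraceProduct

/-!
# Crux `GrenetZeon.TwoDimCoefficients` (stmt-ValiantsHypothesis-8062): at `n = 3`,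
# two-dimensional coefficients DO buy something — `per_3` has a `(6, 2)`-representation, `dc(per_3) = 7`

The crux `TwoDimCoefficients` says that an `(m, ≤ 2)`-representation of `per_n` (coefficients in
a commutative `ℂ`-algebra of dimension `≤ 2`) forces `n² ≤ C·m`, i.e. that the second coefficient
dimension buys at most a constant factor over determinantal complexity.  This file records the
first exact data point, answering the line card's "cheapest falsifier" question for `n = 3`
("a width `≤ 6` resolvent-trace expression [for `per_3`] would already show the model is stronger
than `dc` — informative either way"):

* `perPoly_three_eq_trace_prod` — **the `2 × 2` identity**
  `per_3 = tr ( [[x₃₃, x₁₃], [x₃₂, x₁₂]] · [[x₁₂, x₁₁], [x₃₂, x₃₁]] · [[x₂₁, 0], [x₂₂, x₂₃]] )`: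
  the Laplace expansion along the middle row, the three complementary `2 × 2` permanents being
  three entries of ONE product of two `2 × 2` matrices of variables (the fourth entry `2x₁₂x₃₂`
  is killed by the zero).  So the trace-product width of `per_3` is `2` (found by a numerical
  search, then read off exactly; `1` is impossible since `per_3` is irreducible).
* `dualUnipotentRepr_perPoly_three : DualUnipotentRepr 3 6` — by the embedding
  `dualUnipotentRepr_of_trace_prod` (`m = n·w = 3·2`): `per_3 = tr(adj A·B)` with `A`, `B` affine
  `6 × 6`, `det A = 1`.
* `hasDim2Repr_of_dualRepr` — the easy converse of `stub_classify` in the dual shape: a dual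
  representation `per_n = α det A + β tr(adj A·B)` IS an `(m, ≤ 2)`-representation over the dual
  numbers `ℂ[ε]` (`det(A + εB) = det A + ε·tr(adj A·B)`, Jacobi), read through
  `l(a + bε) = αa + βb`.
* `hasDim2Repr_perPoly_three_six : HasDim2Repr 3 6`, while
  `not_hasDetRepr_perPoly_three_six : ¬ HasDetRepr per_3 6` (`dc(per_3) = 7`, Alper–Bogart–Velasco,
  proved in the tree): **`per_3` has a `(6, 2)`-representation and no `(6, 1)`-representation**
  (`dimTwo_beats_dimOne_perPoly_three`).  For the crux this only forces `C ≥ 3/2` at `n = 3`; it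
  does not bear on the asymptotic claim, and `VP ≠ VNP` is not moved.

References: J. Alper, T. Bogart, M. Velasco, *A lower bound for the determinantal complexity of a
hypersurface*, Found. Comput. Math. 17 (2017), Cor. 1.4 (`dc(per_3) = 7`); B. Grenet, *An upper
bound for the permanent versus determinant problem* (2011); L. G. Valiant, STOC 1979, §2.
-/

-- single-conjunct layout `Summits/ValiantsHypothesis/ValiantsHypothesis`: the duplicated namespace
-- component is mandated by the tree.
set_option linter.dupNamespace false

noncomputable section

namespace Summit.ValiantsHypothesis.ValiantsHypothesis.Cruxes.TwoDimCoefficients.DimTwoCases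

open Literature.Computability.AlgebraicComplexity Matrix MvPolynomial

/-! ### Dual representations are `(m, ≤ 2)`-representations (dual numbers) -/

section DualToDim2

open TrivSqZeroExt DualNumber

variable {n m : ℕ}

/-- `DualUnipotentRepr` is a special case of `DualRepr`. [folklore] -/
theorem dualRepr_of_dualUnipotentRepr (h : DualUnipotentRepr n m) : DualRepr n m := by
  obtain ⟨α, β, c, A, B, hA, hB, -, -, hper⟩ := h
  exact ⟨α, β, A, B, hA, hB, hper⟩

/-- **The dual shape is an `(m, ≤ 2)`-representation over `ℂ[ε]`** (easy converse of
`stub_classify`): from `per_n = α det A + β tr(adj A·B)` take `R = ℂ[ε]/ε²`, the affine matrix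
`A + εB` over `R[x]` — `det(A + εB) = det A + ε tr(adj A·B)` by Jacobi to first order — and the
functional `l(a + bε) = αa + βb`. [folklore] -/
theorem hasDim2Repr_of_dualRepr (h : DualRepr n m) : HasDim2Repr n m := by
  obtain ⟨α, β, A, B, hA, hB, hper⟩ := h
  let ι : MvPolynomial (Fin n × Fin n) ℂ →+* MvPolynomial (Fin n × Fin n) (DualNumber ℂ) :=
    MvPolynomial.map (TrivSqZeroExt.inlHom ℂ ℂ)
  let A' : Matrix (Fin m) (Fin m) (MvPolynomial (Fin n × Fin n) (DualNumber ℂ)) :=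
    ι.mapMatrix A +
      (MvPolynomial.C (ε : DualNumber ℂ) : MvPolynomial (Fin n × Fin n) (DualNumber ℂ)) • ι.mapMatrix B
  let l : DualNumber ℂ →ₗ[ℂ] ℂ :=
    α • (TrivSqZeroExt.fstHom ℂ ℂ ℂ).toLinearMap + β • TrivSqZeroExt.sndHom ℂ ℂ
  have hεε : (MvPolynomial.C (ε : DualNumber ℂ) : MvPolynomial (Fin n × Fin n) (DualNumber ℂ)) *
      MvPolynomial.C (ε : DualNumber ℂ) = 0 := by
    rw [← map_mul, DualNumber.eps_mul_eps, map_zero]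
  have htr : ∀ M : AffMat n m, (ι.mapMatrix M).trace = ι M.trace := by
    intro M
    simp only [Matrix.trace, Matrix.diag_apply, RingHom.mapMatrix_apply, Matrix.map_apply, map_sum]
  have hdet : A'.det = ι A.det + MvPolynomial.C (ε : DualNumber ℂ) * ι (A.adjugate * B).trace := by
    change (ι.mapMatrix A + (MvPolynomial.C (ε : DualNumber ℂ) :
      MvPolynomial (Fin n × Fin n) (DualNumber ℂ)) • ι.mapMatrix B).det = _
    rw [det_add_smul_of_mul_self_eq_zero hεε, ← RingHom.map_det, ← RingHom.map_adjugate,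
      ← map_mul, htr (A.adjugate * B)]
  refine ⟨DualNumber ℂ, inferInstance, inferInstance, inferInstanceAs (Module.Finite ℂ (ℂ × ℂ)),
    ?_, l, A', ?_, ?_⟩
  · -- `dim ℂ[ε] = 2`
    show Module.finrank ℂ (ℂ × ℂ) ≤ 2
    rw [Module.finrank_prod, Module.finrank_self]
  · -- affine entries
    intro i j
    simp only [A', Matrix.add_apply, Matrix.smul_apply, RingHom.mapMatrix_apply, Matrix.map_apply,
      smul_eq_mul]
    refine (totalDegree_add _ _).trans (max_le ?_ ?_)
    · exact (totalDegree_map_le _ _).trans (hA i j)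
    · refine (totalDegree_mul _ _).trans ?_
      rw [totalDegree_C, zero_add]
      exact (totalDegree_map_le _ _).trans (hB i j)
  · -- coefficients
    intro d
    rw [hdet, coeff_add, coeff_C_mul, coeff_map, coeff_map, hper, coeff_add, coeff_C_mul,
      coeff_C_mul]
    simp [l, TrivSqZeroExt.fstHom, TrivSqZeroExt.fst_mul, TrivSqZeroExt.snd_mul,
      DualNumber.fst_eps, DualNumber.snd_eps]

end DualToDim2

/-! ### `per_3` is the trace of a product of three `2 × 2` matrices of variables -/

section PerThree

/-- The three `2 × 2` factors: `[[x₃₃, x₁₃], [x₃₂, x₁₂]]`, `[[x₁₂, x₁₁], [x₃₂, x₃₁]]`,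
`[[x₂₁, 0], [x₂₂, x₂₃]]` (0-indexed variables `X (i, j)`). [folklore] -/
theorem perPoly_three_eq_trace_prod :
    perPoly (Fin 3) ℂ =
      ((List.ofFn (fun t : Fin 3 => (![!![X (2, 2), X (0, 2); X (2, 1), X (0, 1)],
          !![X (0, 1), X (0, 0); X (2, 1), X (2, 0)],
          !![X (1, 0), 0; X (1, 1), X (1, 2)]] :
            Fin 3 → AffMat 3 2) t)).prod).trace := by
  rw [perPoly_fin_three]
  have hl : ∀ (Y : Fin 3 → AffMat 3 2), (List.ofFn Y).prod = Y 0 * (Y 1 * Y 2) := by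
    intro Y
    rw [List.ofFn_succ, List.prod_cons, List.ofFn_succ, List.prod_cons, List.ofFn_succ,
      List.prod_cons, List.ofFn_zero, List.prod_nil, mul_one]
    rfl
  rw [hl]
  simp only [Matrix.cons_val_zero, Matrix.cons_val_one, Matrix.cons_val_two, Matrix.head_cons,
    Matrix.tail_cons, Matrix.trace_fin_two, Matrix.mul_apply, Fin.sum_univ_two, Matrix.of_apply,
    Matrix.cons_val', Matrix.empty_val', Matrix.cons_val_fin_one]
  ring

/-- The three factors are affine (indeed each entry is a variable or `0`). [folklore] -/
theorem isAffine_perPoly_three_factors (t : Fin 3) :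
    IsAffine ((![!![X (2, 2), X (0, 2); X (2, 1), X (0, 1)],
        !![X (0, 1), X (0, 0); X (2, 1), X (2, 0)],
        !![X (1, 0), 0; X (1, 1), X (1, 2)]] : Fin 3 → AffMat 3 2) t) := by
  intro a b
  fin_cases t <;> fin_cases a <;> fin_cases b <;>
    simp [totalDegree_X]

/-- **`per_3` has a unipotent dual representation of size `6`:** `per_3 = tr(adj A·B)` with `A`, `B`
affine `6 × 6` over `ℂ[x]`, `det A = 1` (the chain/corner embedding of the `2 × 2` trace
product, `m = n·w = 3·2`). [folklore] -/
theorem dualUnipotentRepr_perPoly_three : DualUnipotentRepr 3 6 :=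
  dualUnipotentRepr_of_trace_prod (n := 3) (w := 2) (by norm_num) _ isAffine_perPoly_three_factors
    perPoly_three_eq_trace_prod

/-- **`per_3` has a `(6, 2)`-representation** (coefficients in the dual numbers). [folklore] -/
theorem hasDim2Repr_perPoly_three_six : HasDim2Repr 3 6 :=
  hasDim2Repr_of_dualRepr (dualRepr_of_dualUnipotentRepr dualUnipotentRepr_perPoly_three)

/-- **`per_3` has no `(6, 1)`-representation:** `¬ HasDetRepr per_3 6`, since `dc(per_3) ≥ 7`
(Alper–Bogart–Velasco 2017, Cor. 1.4, proved in the tree). [cite: AlperBogartVelasco2017, Cor. 1.4] -/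
theorem not_hasDetRepr_perPoly_three_six : ¬ HasDetRepr (perPoly (Fin 3) ℂ) 6 := by
  intro h
  have h7 := AlperBogartVelasco.seven_le_determinantalComplexity_perPoly_three ℂ two_ne_zero
  have h6 := determinantalComplexity_le_of_hasDetRepr h
  omega

/-- **Two-dimensional coefficients beat one-dimensional ones at `n = 3`:** `per_3` has an
`(m, ≤ 2)`-representation with `m = 6` but determinantal complexity `7`.  (For the crux
`TwoDimCoefficients` this only says `C ≥ 3/2` at `n = 3`; the asymptotic claim is untouched and
`VP ≠ VNP` is not moved.) [cite: AlperBogartVelasco2017, Cor. 1.4] -/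
theorem dimTwo_beats_dimOne_perPoly_three :
    HasDim2Repr 3 6 ∧ ¬ HasDetRepr (perPoly (Fin 3) ℂ) 6 ∧
      determinantalComplexity (perPoly (Fin 3) ℂ) = 7 :=
  ⟨hasDim2Repr_perPoly_three_six, not_hasDetRepr_perPoly_three_six,
    (alperBogartVelasco2017_cor_1_4_complex alperBogartVelasco2017_cor_1_4_holds).1⟩

end PerThree

end Summit.ValiantsHypothesis.ValiantsHypothesis.Cruxes.TwoDimCoefficients.DimTwoCases

end
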